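/-
Copyright (c) 2026. All rights reserved.
Released under Apache 2.0 license as described in the file LICENSE.
-/
import Literature.NumberTheory.NumberFields.NonGaloisQuarticCMFieldNormalClosure
import Literature.NumberTheory.NumberFields.CyclicCubicField13
import Mathlib.FieldTheory.LinearDisjoint
import Mathlib.GroupTheory.SpecificGroups.Cyclic
import Mathlib.GroupTheory.SpecificGroups.Dihedral
import HarnessLib

/-!
# A Galois CM field with Galois group `D₄ × ℤ/3`: the compositum `ℚ(α, β) · ℚ(θ₁₃) ⊂ ℂ`

The field needed to make S. P. White's THEOREM 1 [White1993SporadicCycles, §1] («There exists a CM-type `(K, S)`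
with no sporadic subsets `Δ` whose Mumford–Tate group has rank less than `d + 1`. … Obviously if such a field exists
then Theorem 4 implies Theorem 1», §5 p. 132; §10: «We still need to show that there is a Galois totally complex
field whose Galois group is …») UNCONDITIONAL in the tree for the group `D₄ × ℤ/3` of
`ComplexMultiplication/DihedralCubicSporadicFreeDegenerateCMType`: the compositum `L = N · C` inside `ℂ` of

* `N = ℚ(α, β)`, the Galois closure in `ℂ` of the non-Galois quartic CM field `K = ℚ(√−(3+√2))` — a CM field, Galois
  over `ℚ` of degree `8` with `Gal(N/ℚ) ≃ D₄` (Streng, Lemma I.3.4 (3); tree `NonGaloisQuarticCMFieldNormalClosure`: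
  `isCMField_normalClosure_KD`, `finrank_normalClosure_KD`, `nonempty_dihedralGroup_mulEquiv_gal_normalClosure_KD`), and
* `C = ℚ(θ)`, `θ³ + θ² − 4θ + 1 = 0`, the (image under a real embedding of the) cyclic cubic field of conductor `13` —
  totally real, Galois of degree `3` (tree `CyclicCubicField13`: `finrank_K`, `card_gal`, `isGalois`, the real
  embeddings `e₁, e₂, e₃`).

By the Galois theory of composita (Brzeziński, Exercise 9.15: «Let `M₁ ⊇ K` and `M₂ ⊇ K` be finite Galois extensions
and `L` a field which contains both … (a) `M₁M₂ ⊇ K` … [is a] Galois extension; … (c) `G(M₁M₂/K) ≅ G(M₁/K) × G(M₂/K)`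
if `M₁ ∩ M₂ = K`»; here `[N : ℚ] = 8` and `[C : ℚ] = 3` are coprime, so `N` and `C` are linearly disjoint) and
Shimura's §18.2 Lemma (ii) («The composite of finitely many CM-fields [and totally real fields] is a CM-field», tree
`IntermediateField.isCMField_sup_of_isCMField_left`):

* `isTotallyReal_K₁₃` — the cyclic cubic field of conductor `13` is totally real (it is Galois with a real embedding);
  `C`, `finrank_C = 3`, `isGalois_C`, `isTotallyReal_C`;
* `L = N ⊔ C`: `finrank_L = 24`, `numberField_L`, **`isCMField_L`**, **`isGalois_L`**;
* `res : Gal(L/ℚ) → Gal(N/ℚ) × Gal(C/ℚ)` (restriction; `res_fst_apply`, `res_snd_apply`), `fixedField_ker_res` (the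
  field fixed by `ker res` contains `N` and `C`, hence is `L`), `res_injective`, `res_bijective` (orders `24 = 8 · 3`),
  `galEquivProd : Gal(L/ℚ) ≃* Gal(N/ℚ) × Gal(C/ℚ)`, **`nonempty_mulEquiv_gal_L : Gal(L/ℚ) ≃* D₄ × ℤ/3`**,
  `card_gal_L = 24`.

Theorems and definitions with bodies (`φ₁₃`, `C`, `eC`, `N`, `L`, the inclusions `inclN`, `inclC`, `valL`, the
`N`- and `C`-algebra structures `algNL`, `algCL` on `L` used only through `letI`, `res`, `galEquivProd`); no named
facts, no instances, no `sorry`.  (Implementation note: all `ℚ`-algebra structures are the ones instance search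
finds on subfields of `ℂ` — `DivisionRing.toRatAlgebra` — so the file avoids `IntermediateField.lift/restrict`, whose
statements fix `IntermediateField.algebra'`.)

## References

* [Brzezinski2018] J. Brzeziński, *Galois Theory Through Exercises* (Springer 2018), Exercise 9.15 (a), (c).
* [Shimura1998] G. Shimura, *Abelian Varieties with Complex Multiplication and Modular Functions*, §18.2 Lemma (ii).
* [Streng2010] M. Streng, *Complex multiplication of abelian surfaces*, Ch. I Lemma 3.4 (3), Example 7.5.
* [White1993SporadicCycles] S. P. White, Compositio Math. 88 (1993), §5 (p. 132), §10 (p. 142).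

## Provenance

Cell `pub-hodgecm2` (COR-CM), literature seat `lit-deligne-3` gen 46 (claim WHITE-THM1-UNCOND, part 2 of 3;
count-neutral).  HC_CM is NOT proved and nothing here bears on it.
-/

set_option autoImplicit false

noncomputable section

namespace Literature.NumberTheory.NumberFields

namespace DihedralCubicCompositum

open NumberField NonGaloisQuarticCM

/-! ## §1 The totally real cyclic cubic field `C = ℚ(θ₁₃) ⊂ ℂ` -/

/-- The real embedding `θ ↦ r₁` of the cubic field, as a `ℚ`-algebra map into `ℂ`. [cite: White1993SporadicCycles, §10 (p. 142)] -/
def φ₁₃ : CyclicCubic13.K →ₐ[ℚ] ℂ := (Complex.ofRealHom.comp CyclicCubic13.e₁).toRatAlgHom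

/-- `φ₁₃ x = e₁ x ∈ ℝ`. [cite: White1993SporadicCycles, §10 (p. 142)] -/
theorem φ₁₃_apply (x : CyclicCubic13.K) : φ₁₃ x = ((CyclicCubic13.e₁ x : ℝ) : ℂ) := rfl

/-- The cyclic cubic field of conductor `13` is TOTALLY REAL: it is Galois over `ℚ` with a real embedding `e₁`, and
every complex embedding is `e₁ ∘ g` for some `g ∈ Gal`. [cite: Brzezinski2018, Exercise 9.15 (d)]
[cite: Shimura1998, §18.2 Lemma (iv)] -/
theorem isTotallyReal_K₁₃ : IsTotallyReal CyclicCubic13.K := by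
  letI : Algebra CyclicCubic13.K ℂ := φ₁₃.toRingHom.toAlgebra
  haveI : IsScalarTower ℚ CyclicCubic13.K ℂ :=
    IsScalarTower.of_algebraMap_eq fun x => (φ₁₃.commutes x).symm
  refine ⟨fun w => ?_⟩
  rw [InfinitePlace.isReal_iff, ComplexEmbedding.isReal_iff]
  refine RingHom.ext fun x => ?_
  let ψ : CyclicCubic13.K →ₐ[ℚ] ℂ := (w.embedding).toRatAlgHom
  have hcomm : w.embedding x = φ₁₃ (ψ.restrictNormal CyclicCubic13.K x) :=
    (AlgHom.restrictNormal_commutes ψ CyclicCubic13.K x).symm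
  rw [ComplexEmbedding.conjugate_coe_eq, hcomm, φ₁₃_apply]
  exact Complex.conj_ofReal _

/-- **`C = ℚ(θ₁₃) ⊂ ℂ`**, the image of the cyclic cubic field of conductor `13` under its real embedding `e₁`.
[cite: White1993SporadicCycles, §10 (p. 142: «a real extension … which is disjoint»)] -/
def C : IntermediateField ℚ ℂ := φ₁₃.fieldRange

/-- `K₁₃ ≃ C`. [cite: Brzezinski2018, Exercise 9.15] -/
def eC : CyclicCubic13.K ≃ₐ[ℚ] C := AlgEquiv.ofInjectiveField φ₁₃

/-- `[C : ℚ] = 3`. [cite: White1993SporadicCycles, §10 (p. 142)] -/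
theorem finrank_C : Module.finrank ℚ C = 3 := by
  rw [← eC.toLinearEquiv.finrank_eq, CyclicCubic13.finrank_K]

/-- `C` is finite over `ℚ`. [cite: White1993SporadicCycles, §10 (p. 142)] -/
theorem finiteDimensional_C : FiniteDimensional ℚ C := Module.finite_of_finrank_eq_succ finrank_C

/-- `C/ℚ` is Galois (cyclic cubic). [cite: Brzezinski2018, Exercise 9.15 (a)] -/
theorem isGalois_C : IsGalois ℚ C := IsGalois.of_algEquiv eC

/-- `C` is totally real. [cite: Shimura1998, §18.2 Lemma (iv)] -/
theorem isTotallyReal_C : IsTotallyReal C :=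
  haveI := isTotallyReal_K₁₃
  IsTotallyReal.ofRingEquiv eC.toRingEquiv

/-- `|Gal(C/ℚ)| = 3`. [cite: Brzezinski2018, Exercise 9.15 (c)] -/
theorem card_gal_C : Nat.card (C ≃ₐ[ℚ] C) = 3 := by
  rw [← Nat.card_congr (AlgEquiv.autCongr eC).toEquiv, CyclicCubic13.card_gal]

/-! ## §2 The compositum `L = N · C`, `N = ℚ(α, β)` the Galois closure of `ℚ(√−(3+√2))` -/

/-- `N = ℚ(α, β) ⊂ ℂ`, the Galois closure of `K = ℚ(√−(3+√2))`. [cite: Streng2010, Ch. I Lemma 3.4 (3)] -/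
abbrev N : IntermediateField ℚ ℂ := IntermediateField.normalClosure ℚ KD ℂ

/-- **`L = N ⊔ C ⊂ ℂ`**: the compositum of the Galois closure `N` of `ℚ(√−(3+√2))` and the cubic field `C`.
[cite: White1993SporadicCycles, §10 (p. 142)] [cite: Shimura1998, §18.2 Lemma (ii)] -/
def L : IntermediateField ℚ ℂ := N ⊔ C

/-- `N ≤ L`. [cite: Shimura1998, §18.2 Lemma (ii)] -/
theorem N_le_L : N ≤ L := le_sup_left

/-- `C ≤ L`. [cite: Shimura1998, §18.2 Lemma (ii)] -/
theorem C_le_L : C ≤ L := le_sup_right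

/-- `N` is finite over `ℚ`. [cite: Streng2010, Ch. I Lemma 3.4 (3)] -/
theorem finiteDimensional_N : FiniteDimensional ℚ N := Module.finite_of_finrank_eq_succ finrank_normalClosure_KD

/-- `L` is finite over `ℚ`. [cite: Shimura1998, §18.2 Lemma (ii)] -/
theorem finiteDimensional_L : FiniteDimensional ℚ L :=
  haveI := finiteDimensional_N
  haveI := finiteDimensional_C
  IntermediateField.finiteDimensional_sup N C

/-- `L` is a number field. [cite: Shimura1998, §18.2 Lemma (ii)] -/
theorem numberField_L : NumberField L :=
  haveI := finiteDimensional_L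
  { to_charZero := inferInstance, to_finiteDimensional := inferInstance }

/-- **`[L : ℚ] = 24`**: `[N : ℚ] = 8` and `[C : ℚ] = 3` are coprime, so `N`, `C` are linearly disjoint and
`[NC : ℚ] = 24`. [cite: Brzezinski2018, Exercise 9.15 (c) («if `M₁ ∩ M₂ = K`»)] -/
theorem finrank_L : Module.finrank ℚ L = 24 := by
  haveI := finiteDimensional_N
  haveI := finiteDimensional_C
  have hcop : (Module.finrank ℚ N).Coprime (Module.finrank ℚ C) := by
    rw [finrank_normalClosure_KD, finrank_C]; decide
  have hld : N.LinearDisjoint C := IntermediateField.LinearDisjoint.of_finrank_coprime hcop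
  change Module.finrank ℚ ↥(N ⊔ C) = 24
  rw [hld.finrank_sup, finrank_normalClosure_KD, finrank_C]

/-- **`L` is a CM field** (compositum of a CM field and a totally real field, Shimura §18.2 Lemma (ii)).
[cite: Shimura1998, §18.2 Lemma (ii)] -/
theorem isCMField_L : IsCMField L :=
  haveI := finiteDimensional_N
  haveI := finiteDimensional_C
  IntermediateField.isCMField_sup_of_isCMField_left N C isCMField_normalClosure_KD (Or.inl isTotallyReal_C)

/-- **`L/ℚ` is Galois** (compositum of Galois extensions). [cite: Brzezinski2018, Exercise 9.15 (a)] -/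
theorem isGalois_L : IsGalois ℚ L := by
  haveI := finiteDimensional_L
  have hN : Normal ℚ N := @IsGalois.to_normal _ _ _ _ _ isGalois_normalClosure_KD
  have hC : Normal ℚ C := @IsGalois.to_normal _ _ _ _ _ isGalois_C
  haveI : Normal ℚ L := @IntermediateField.normal_sup ℚ ℂ _ _ _ N C hN hC
  exact IsGalois.mk

/-- `|Gal(L/ℚ)| = 24`. [cite: Brzezinski2018, Exercise 9.15 (c)] -/
theorem card_gal_L : Nat.card (L ≃ₐ[ℚ] L) = 24 := by
  haveI := finiteDimensional_L
  haveI := isGalois_L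
  rw [IsGalois.card_aut_eq_finrank, finrank_L]

/-! ## §3 `Gal(L/ℚ) ≃ Gal(N/ℚ) × Gal(C/ℚ) ≃ D₄ × ℤ/3` -/

/-- The inclusion `N ↪ L`. [cite: Brzezinski2018, Exercise 9.15] -/
def inclN : N →ₐ[ℚ] L where
  toFun x := ⟨x.1, N_le_L x.2⟩
  map_one' := rfl
  map_mul' _ _ := rfl
  map_zero' := rfl
  map_add' _ _ := rfl
  commutes' _ := rfl

/-- The inclusion `C ↪ L`. [cite: Brzezinski2018, Exercise 9.15] -/
def inclC : C →ₐ[ℚ] L where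
  toFun x := ⟨x.1, C_le_L x.2⟩
  map_one' := rfl
  map_mul' _ _ := rfl
  map_zero' := rfl
  map_add' _ _ := rfl
  commutes' _ := rfl

/-- The inclusion `L ↪ ℂ`. [cite: Brzezinski2018, Exercise 9.15] -/
def valL : L →ₐ[ℚ] ℂ where
  toFun x := x.1
  map_one' := rfl
  map_mul' _ _ := rfl
  map_zero' := rfl
  map_add' _ _ := rfl
  commutes' _ := rfl

/-- `L` as an `N`-algebra. [cite: Brzezinski2018, Exercise 9.15] -/
abbrev algNL : Algebra N L := inclN.toRingHom.toAlgebra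

/-- `L` as a `C`-algebra. [cite: Brzezinski2018, Exercise 9.15] -/
abbrev algCL : Algebra C L := inclC.toRingHom.toAlgebra

/-- `ℚ ⊂ N ⊂ L` is a tower. [cite: Brzezinski2018, Exercise 9.15] -/
theorem isScalarTower_NL : letI := algNL; IsScalarTower ℚ N L :=
  letI := algNL
  IsScalarTower.of_algebraMap_eq fun q => (inclN.commutes q).symm

/-- `ℚ ⊂ C ⊂ L` is a tower. [cite: Brzezinski2018, Exercise 9.15] -/
theorem isScalarTower_CL : letI := algCL; IsScalarTower ℚ C L :=
  letI := algCL
  IsScalarTower.of_algebraMap_eq fun q => (inclC.commutes q).symm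

/-- **Restriction `Gal(L/ℚ) → Gal(N/ℚ) × Gal(C/ℚ)`, `σ ↦ (σ|_N, σ|_C)`** (`N/ℚ`, `C/ℚ` normal).
[cite: Brzezinski2018, Exercise 9.15 (c)] -/
def res : (L ≃ₐ[ℚ] L) →* (N ≃ₐ[ℚ] N) × (C ≃ₐ[ℚ] C) :=
  letI := algNL
  letI := algCL
  haveI := isScalarTower_NL
  haveI := isScalarTower_CL
  haveI : Normal ℚ N := by haveI := isGalois_normalClosure_KD; infer_instance
  haveI : Normal ℚ C := by haveI := isGalois_C; infer_instance
  (AlgEquiv.restrictNormalHom N).prod (AlgEquiv.restrictNormalHom C)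

/-- `(σ|_N)(x) = σ(x)` for `x ∈ N`. [cite: Brzezinski2018, Exercise 9.15 (c)] -/
theorem res_fst_apply (σ : L ≃ₐ[ℚ] L) (x : N) : inclN ((res σ).1 x) = σ (inclN x) := by
  letI := algNL
  letI := algCL
  haveI := isScalarTower_NL
  haveI := isScalarTower_CL
  haveI : Normal ℚ N := by haveI := isGalois_normalClosure_KD; infer_instance
  haveI : Normal ℚ C := by haveI := isGalois_C; infer_instance
  exact AlgEquiv.restrictNormal_commutes σ N x

/-- `(σ|_C)(y) = σ(y)` for `y ∈ C`. [cite: Brzezinski2018, Exercise 9.15 (c)] -/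
theorem res_snd_apply (σ : L ≃ₐ[ℚ] L) (y : C) : inclC ((res σ).2 y) = σ (inclC y) := by
  letI := algNL
  letI := algCL
  haveI := isScalarTower_NL
  haveI := isScalarTower_CL
  haveI : Normal ℚ N := by haveI := isGalois_normalClosure_KD; infer_instance
  haveI : Normal ℚ C := by haveI := isGalois_C; infer_instance
  exact AlgEquiv.restrictNormal_commutes σ C y

/-- The subfield of `L` fixed by the kernel of the restriction map contains `N` and `C`, hence is all of `L = NC`.
[cite: Brzezinski2018, Exercise 9.15 (c)] -/
theorem fixedField_ker_res : IntermediateField.fixedField res.ker = ⊤ := by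
  apply top_unique
  intro y _
  -- `y ∈ L = N ⊔ C` lies in the image of the fixed field under `valL`, which contains `N` and `C`
  have hN : N ≤ (IntermediateField.fixedField res.ker).map valL := by
    intro z hz
    refine (IntermediateField.mem_map _).2 ⟨inclN ⟨z, hz⟩, ?_, rfl⟩
    rw [IntermediateField.mem_fixedField_iff]
    intro f hf
    have h := res_fst_apply f ⟨z, hz⟩
    rw [MonoidHom.mem_ker] at hf
    rw [hf] at h
    exact h.symm
  have hC : C ≤ (IntermediateField.fixedField res.ker).map valL := by
    intro z hz
    refine (IntermediateField.mem_map _).2 ⟨inclC ⟨z, hz⟩, ?_, rfl⟩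
    rw [IntermediateField.mem_fixedField_iff]
    intro f hf
    have h := res_snd_apply f ⟨z, hz⟩
    rw [MonoidHom.mem_ker] at hf
    rw [hf] at h
    exact h.symm
  have hL : L ≤ (IntermediateField.fixedField res.ker).map valL := sup_le hN hC
  obtain ⟨y', hy', hyy⟩ := (IntermediateField.mem_map _).1 (hL y.2)
  have : y' = y := Subtype.ext hyy
  rwa [this] at hy'

/-- **The restriction map is injective**: an automorphism of `L = NC` trivial on `N` and on `C` is trivial.
[cite: Brzezinski2018, Exercise 9.15 (c)] -/
theorem res_injective : Function.Injective res := by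
  refine (injective_iff_map_eq_one _).mpr fun σ hσ => ?_
  have hmem : σ ∈ res.ker := (MonoidHom.mem_ker).2 hσ
  ext y
  have hy : y ∈ IntermediateField.fixedField res.ker := by rw [fixedField_ker_res]; trivial
  exact congrArg Subtype.val ((IntermediateField.mem_fixedField_iff _ _).1 hy σ hmem)

/-- **The restriction map is bijective** (injective between groups of order `24 = 8 · 3`).
[cite: Brzezinski2018, Exercise 9.15 (c)] -/
theorem res_bijective : Function.Bijective res := by
  haveI := finiteDimensional_L
  haveI := finiteDimensional_N
  haveI := finiteDimensional_C
  refine res_injective.bijective_of_nat_card_le ?_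
  rw [Nat.card_prod, card_gal_normalClosure_KD, card_gal_C, card_gal_L]

/-- **`Gal(L/ℚ) ≃* Gal(N/ℚ) × Gal(C/ℚ)`.** [cite: Brzezinski2018, Exercise 9.15 (c)] -/
def galEquivProd : (L ≃ₐ[ℚ] L) ≃* (N ≃ₐ[ℚ] N) × (C ≃ₐ[ℚ] C) := MulEquiv.ofBijective res res_bijective

/-- **`Gal(L/ℚ) ≃ D₄ × ℤ/3`** — `L` is a Galois CM field whose Galois group is the group `Γ` of
`DihedralCubicSporadicFreeDegenerateCMType`. [cite: Brzezinski2018, Exercise 9.15 (c)] [cite: Streng2010, Ch. I Lemma 3.4 (3)] -/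
theorem nonempty_mulEquiv_gal_L : Nonempty ((L ≃ₐ[ℚ] L) ≃* DihedralGroup 4 × Multiplicative (ZMod 3)) := by
  obtain ⟨eD⟩ := nonempty_dihedralGroup_mulEquiv_gal_normalClosure_KD
  haveI : Fact (Nat.Prime 3) := ⟨Nat.prime_three⟩
  have h3 : Nat.card (Multiplicative (ZMod 3)) = 3 := by simp
  exact ⟨galEquivProd.trans (MulEquiv.prodCongr eD.symm (mulEquivOfPrimeCardEq card_gal_C h3))⟩

end DihedralCubicCompositum

end Literature.NumberTheory.NumberFields
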